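import Summits.ValiantsHypothesis.ValiantsHypothesis.Theorems.LacunarySymmetroidMatrixDescartesDoorA26WallBubblingBubblingNormalisation
import Summits.ValiantsHypothesis.ValiantsHypothesis.Theorems.LacunarySymmetroidMatrixDescartesCensusDoorA34RankOneLetter
import Summits.ValiantsHypothesis.ValiantsHypothesis.Theorems.LacunarySymmetroidMatrixDescartesCensusDoorA34IsotropicCoreWindow
import Summits.ValiantsHypothesis.ValiantsHypothesis.Theorems.SymmetroidPencilBasics

/-!
# `MatrixDescartes` census — DOOR A at `(3,4)`: the GRAM of a three-letter `2 × 2` window pencil — REALISABILITY as a square, the pencil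
# determinant as a Gram quadratic form, and DEGENERATE GRAM ⇒ at most FOUR positive roots (so five roots force a nondegenerate Lorentzian Gram)

HONEST FRAMING.  Object-search cell `pub-symmetroid`, engine seat `val-sym-eng-2` (g10); helper row beside the registered strata line
`Cruxes/DoorA34/Lines/strata.lean` on stmt-ValiantsHypothesis-19980 (`DoorA34 = PosRootLawAt 3 4 18`: OPEN, typed, never asserted here), stub `stub_nullTopCeiling`.
WHY A `2 × 2` FILE ON THE `(3,4)` SHEET.  In the window anatomy of a null-top `(3,4)` pencil with a two-scale rank-two top letter (every window-family record of the
tree is of this kind — seat report HOME/DOOR-A34-ENG2G10-REPORT.md §6(e)) the middle block is the determinant of a `2 × 2` symmetric three-letter compression `F|Π`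
and the top block is a diagonal entry `kᵀFk` of it.  The seat's located ★ ORIENTATION LAW (report §6(c); 22 993/22 993 exact configurations, analytic proof
sketch, NOT a kernel fact) says: «a real symmetric `2 × 2` pencil on a window support whose determinant has FIVE positive roots is DEFINITE beyond its last root»
— whence «lose two to gain one» (middle block with 5 window roots ⇒ top block root-free beyond ⇒ anatomy ≤ 16; `(9,4,2) + 2` junctions `= 17` is the
regime's ceiling = the stub's `17`).  THIS FILE lands the two KERNEL halves of that law which are pure algebra, in the vocabulary of the DoorA26 line
(`WallBubbling.Bubbling.polar`, …BubblingDefs/…Normalisation):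

* `polarGram_det_eq_sq_div_four` — **REALISABILITY AS A SQUARE**: for three symmetric `2 × 2` letters the `3 × 3` polar Gram matrix `[polar Sᵢ Sⱼ]` has
  determinant `(det M)²/4`, `M` = the `3 × 3` matrix of letter coordinates `(S 0 0, S 0 1, S 1 1)` — the determinant form of `Sym₂(ℝ)` has signature `(1,2)`;
  `polarGram_det_nonneg`; `polarGram_det_eq_zero_iff` (degenerate Gram ⟺ `det M = 0`).
* `det_pencil_fin_two_eq_polarGram` — the pencil determinant IS the Gram quadratic form: `det(Σₗ X^{dₗ}·Sₗ) = Σₖ Σₗ C(polar Sₖ Sₗ)·X^{dₖ+dₗ}` (polynomial level;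
  pointwise this is …Normalisation's `det_sum_smul_fin_two`).
* `det_smul_add_smul_fin_two` — `det(φ·A + ψ·B) = det A·φ² + 2·polar(A,B)·φψ + det B·ψ²`;
* **`posRoots_le_four_of_letter_mem_span`** — if one letter of a three-letter `2 × 2` pencil `Σₗ X^{dₗ}·Sₗ` is a combination of the other two (DEGENERATE GRAM,
  generic case) then `det` has at most `4` distinct positive roots — by the tree's `Census.card_posRoots_binaryForm_le_four` (…IsotropicCoreWindow, this lineage g2:
  a binary quadratic form of two trinomials has `≤ 4` positive roots).  Contrapositive: FIVE positive roots force the third letter off the span of the first two.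

Nothing here is located; nothing bounds the sheet; `DoorA34` and the three stubs stay OPEN; registers unchanged (`ζ_sym(3,4) ∈ {18,19}`); nothing on
`MatrixDescartes` (stmt-ValiantsHypothesis-18050), on `DoorA26` (stmt-ValiantsHypothesis-19979) or on `VP ≠ VNP` — VP≠VNP not moved.
[folklore] The determinant of `Sym₂(ℝ)` as a Lorentz form; Descartes' bound by monomial count (`card_roots_toFinset_filter_pos_lt_card_support`).
-/

-- `Summit.ValiantsHypothesis.ValiantsHypothesis.…` repeats a component by the D-0017 layout
-- (single-conjunct summit), which the `dupNamespace` linter flags; the name is mandated.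
set_option linter.dupNamespace false

namespace Summit.ValiantsHypothesis.ValiantsHypothesis.Theorems.LacunarySymmetroidMatrixDescartes.Census

open Summit.ValiantsHypothesis.ValiantsHypothesis.Theorems.LacunarySymmetroidMatrixDescartes.WallBubbling.Bubbling (polar polar_apply det_sum_smul_fin_two)
open Summit.ValiantsHypothesis.ValiantsHypothesis.Theorems.SymmetroidDescartes (eval_det_pencil)
open scoped BigOperators Matrix
open Polynomial Finset

/-! ## 1. Realisability: the polar Gram of three symmetric letters is a square over four -/

/-- **REALISABILITY AS A SQUARE**: `det [polar Sᵢ Sⱼ]_{i,j<3} = (det M)² / 4`, `M` the matrix of letter coordinates `(S 0 0, S 0 1, S 1 1)`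
(symmetric letters). [folklore] -/
theorem polarGram_det_eq_sq_div_four (S : Fin 3 → Matrix (Fin 2) (Fin 2) ℝ) (hS : ∀ l, (S l).IsSymm) :
    (Matrix.of fun i j : Fin 3 => polar (S i) (S j)).det
      = (Matrix.of fun (i : Fin 3) (c : Fin 3) => ![S i 0 0, S i 0 1, S i 1 1] c).det ^ 2 / 4 := by
  have h10 : ∀ l, S l 1 0 = S l 0 1 := fun l => by
    simpa [Matrix.transpose_apply] using congrFun (congrFun (hS l) 0) 1
  simp only [Matrix.det_fin_three, Matrix.of_apply, polar_apply, h10, Matrix.cons_val_zero, Matrix.cons_val_one, Matrix.head_cons,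
    Matrix.cons_val_two, Matrix.tail_cons]
  ring

/-- **The polar Gram determinant of three symmetric `2 × 2` letters is `≥ 0`** (signature `(1,2)` of the determinant form of `Sym₂(ℝ)`). [folklore] -/
theorem polarGram_det_nonneg (S : Fin 3 → Matrix (Fin 2) (Fin 2) ℝ) (hS : ∀ l, (S l).IsSymm) :
    0 ≤ (Matrix.of fun i j : Fin 3 => polar (S i) (S j)).det := by
  rw [polarGram_det_eq_sq_div_four S hS]; positivity

/-- **Degenerate Gram ⟺ degenerate letter coordinates.** [folklore] -/
theorem polarGram_det_eq_zero_iff (S : Fin 3 → Matrix (Fin 2) (Fin 2) ℝ) (hS : ∀ l, (S l).IsSymm) :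
    (Matrix.of fun i j : Fin 3 => polar (S i) (S j)).det = 0
      ↔ (Matrix.of fun (i : Fin 3) (c : Fin 3) => ![S i 0 0, S i 0 1, S i 1 1] c).det = 0 := by
  rw [polarGram_det_eq_sq_div_four S hS]
  constructor
  · intro h; nlinarith [sq_nonneg ((Matrix.of fun (i : Fin 3) (c : Fin 3) => ![S i 0 0, S i 0 1, S i 1 1] c).det)]
  · intro h; rw [h]; ring

/-! ## 2. The pencil determinant is the Gram quadratic form -/

/-- **`det(Σₗ X^{dₗ}·Sₗ) = Σₖ Σₗ C(polar Sₖ Sₗ)·X^{dₖ+dₗ}`** for any finite family of real `2 × 2` letters (polynomial level). [folklore] -/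
theorem det_pencil_fin_two_eq_polarGram {K : ℕ} (d : Fin K → ℕ) (S : Fin K → Matrix (Fin 2) (Fin 2) ℝ) :
    (∑ l, (X : ℝ[X]) ^ d l • (S l).map C).det = ∑ k, ∑ l, C (polar (S k) (S l)) * X ^ (d k + d l) := by
  apply Polynomial.funext
  intro t
  rw [eval_det_pencil, det_sum_smul_fin_two, eval_finsetSum]
  refine Finset.sum_congr rfl fun k _ => ?_
  rw [eval_finsetSum]
  refine Finset.sum_congr rfl fun l _ => ?_
  rw [eval_mul, eval_C, eval_pow, eval_X, pow_add]; ring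

/-! ## 3. Degenerate Gram ⇒ at most four positive roots (via the tree's `card_posRoots_binaryForm_le_four`, …IsotropicCoreWindow) -/

/-- The determinant of `φ·A + ψ·B` (`2 × 2`) as a binary quadratic form in `φ, ψ` (middle coefficient `2·polar A B`). [folklore] -/
theorem det_smul_add_smul_fin_two (A B : Matrix (Fin 2) (Fin 2) ℝ) (φ ψ : ℝ[X]) :
    (φ • A.map C + ψ • B.map C).det = C A.det * φ ^ 2 + 2 * C (polar A B) * φ * ψ + C B.det * ψ ^ 2 := by
  have h2 : (2 : ℝ[X]) * C (polar A B) = C (A 0 0 * B 1 1 + B 0 0 * A 1 1 - A 0 1 * B 1 0 - B 0 1 * A 1 0) := by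
    rw [polar_apply, show (2 : ℝ[X]) = C 2 from (map_ofNat C 2).symm, ← map_mul]
    congr 1; ring
  rw [h2]
  simp only [Matrix.det_fin_two, Matrix.add_apply, Matrix.smul_apply, Matrix.map_apply, smul_eq_mul, map_sub, map_add, map_mul]
  ring

/-- **DEGENERATE GRAM ⇒ AT MOST FOUR POSITIVE ROOTS** (generic case: the third letter in the span of the other two).  For `2 × 2` real letters with
`S 2 = a • S 0 + b • S 1`, `det(X^{d₀}·S₀ + X^{d₁}·S₁ + X^{d₂}·S₂)` has at most `4` distinct positive roots — on every support (the determinant is a binary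
quadratic form in the two trinomials `X^{d₀} + a·X^{d₂}`, `X^{d₁} + b·X^{d₂}`: `Census.card_posRoots_binaryForm_le_four`).  Contrapositive: FIVE positive
det-roots force `S 2 ∉ span(S 0, S 1)`. [folklore] -/
theorem posRoots_le_four_of_letter_mem_span (d : Fin 3 → ℕ) (S : Fin 3 → Matrix (Fin 2) (Fin 2) ℝ) (a b : ℝ)
    (h2 : S 2 = a • S 0 + b • S 1) :
    ((Matrix.det (∑ l, ((X : ℝ[X]) ^ d l) • (S l).map C)).roots.toFinset.filter (fun t => 0 < t)).card ≤ 4 := by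
  classical
  -- the pencil is φ·S₀ + ψ·S₁ with φ = X^{d₀} + a X^{d₂}, ψ = X^{d₁} + b X^{d₂}
  set φ : ℝ[X] := C 1 * X ^ d 0 + C 0 * X ^ d 1 + C a * X ^ d 2 with hφ
  set ψ : ℝ[X] := C 0 * X ^ d 0 + C 1 * X ^ d 1 + C b * X ^ d 2 with hψ
  have hpencil : (∑ l, ((X : ℝ[X]) ^ d l) • (S l).map C) = φ • (S 0).map C + ψ • (S 1).map C := by
    ext i j
    simp only [Fin.sum_univ_three, Matrix.add_apply, Matrix.smul_apply, Matrix.map_apply, smul_eq_mul, h2, hφ, hψ, map_add, map_mul,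
      map_one, map_zero, Fin.isValue]
    ring
  rw [hpencil, det_smul_add_smul_fin_two]
  by_cases hB : C (S 0).det * φ ^ 2 + 2 * C (polar (S 0) (S 1)) * φ * ψ + C (S 1).det * ψ ^ 2 = 0
  · rw [hB, roots_zero, Multiset.toFinset_zero, Finset.filter_empty, Finset.card_empty]; omega
  exact card_posRoots_binaryForm_le_four φ ψ (support_trinomial_subset _ _ _ _ _ _) (support_trinomial_subset _ _ _ _ _ _) _ _ _ hB

/-! ## 4. Bracket positivity: trinomials form a Chebyshev system on `(0, ∞)` (the `3 × 3` generalized Vandermonde is positive) -/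

/-- The bracket `[v(r₁) v(r₂) v(x)]`, `v(r) = (1, r^{d₁}, r^{d₂})`, as the trinomial
`(r₁^{d₁} r₂^{d₂} − r₁^{d₂} r₂^{d₁}) − (r₂^{d₂} − r₁^{d₂})·x^{d₁} + (r₂^{d₁} − r₁^{d₁})·x^{d₂}` evaluated at `x`. [folklore] -/
theorem genVandermonde_three_eq_eval_trinomial (d₁ d₂ : ℕ) (r₁ r₂ x : ℝ) :
    Matrix.det !![1, r₁ ^ d₁, r₁ ^ d₂; 1, r₂ ^ d₁, r₂ ^ d₂; 1, x ^ d₁, x ^ d₂]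
      = (Polynomial.trinomial 0 d₁ d₂ (r₁ ^ d₁ * r₂ ^ d₂ - r₁ ^ d₂ * r₂ ^ d₁) (-(r₂ ^ d₂ - r₁ ^ d₂)) (r₂ ^ d₁ - r₁ ^ d₁)).eval x := by
  rw [Polynomial.trinomial_def]
  simp only [eval_add, eval_mul, eval_C, eval_pow, eval_X, pow_zero, mul_one, Matrix.det_fin_three, Matrix.of_apply, Matrix.cons_val',
    Matrix.cons_val_zero, Matrix.cons_val_one, Matrix.cons_val_two, Matrix.empty_val', Matrix.cons_val_fin_one, Matrix.head_cons,
    Matrix.tail_cons, Matrix.head_fin_const]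
  ring

/-- **BRACKET POSITIVITY (trinomial Chebyshev system)**: for `0 < d₁ < d₂` and `0 < r₁ < r₂ < r₃` the generalized Vandermonde determinant
`det[(1, rᵢ^{d₁}, rᵢ^{d₂})]` is POSITIVE.  (The bracket, as a trinomial in the last node, vanishes at `r₁, r₂`, has positive top coefficient, and a third
positive zero is forbidden by Descartes; the intermediate value theorem does the rest.)  These are the ten brackets of report §6(b). [folklore] -/
theorem genVandermonde_three_pos (d₁ d₂ : ℕ) (hd₁ : 0 < d₁) (hd : d₁ < d₂) (r₁ r₂ r₃ : ℝ) (h₁ : 0 < r₁) (h₁₂ : r₁ < r₂) (h₂₃ : r₂ < r₃) :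
    0 < Matrix.det !![1, r₁ ^ d₁, r₁ ^ d₂; 1, r₂ ^ d₁, r₂ ^ d₂; 1, r₃ ^ d₁, r₃ ^ d₂] := by
  classical
  set q : ℝ[X] := Polynomial.trinomial 0 d₁ d₂ (r₁ ^ d₁ * r₂ ^ d₂ - r₁ ^ d₂ * r₂ ^ d₁) (-(r₂ ^ d₂ - r₁ ^ d₂)) (r₂ ^ d₁ - r₁ ^ d₁) with hq
  have h₂ : 0 < r₂ := h₁.trans h₁₂
  have htop : 0 < r₂ ^ d₁ - r₁ ^ d₁ := sub_pos.2 (pow_lt_pow_left₀ h₁₂ h₁.le hd₁.ne')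
  have hqne : q ≠ 0 := by
    intro h0
    have := Polynomial.trinomial_leadingCoeff (k := 0) (u := r₁ ^ d₁ * r₂ ^ d₂ - r₁ ^ d₂ * r₂ ^ d₁) (v := -(r₂ ^ d₂ - r₁ ^ d₂)) hd₁ hd htop.ne'
    rw [← hq, h0, leadingCoeff_zero] at this
    exact htop.ne' this.symm
  -- the bracket vanishes at the first two nodes
  have hroot : ∀ y, y = r₁ ∨ y = r₂ → q.eval y = 0 := by
    rintro y (rfl | rfl)
    · rw [hq, ← genVandermonde_three_eq_eval_trinomial]
      simp [Matrix.det_fin_three]; ring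
    · rw [hq, ← genVandermonde_three_eq_eval_trinomial]
      simp [Matrix.det_fin_three]; ring
  -- Descartes: at most two positive roots (three monomials)
  have hcard : (q.roots.toFinset.filter (fun t => 0 < t)).card ≤ 2 := by
    refine card_posRoots_le_two_of_support_subset_three q hqne (k := 0) (m := d₁) (n := d₂) ?_
    rw [hq, Polynomial.trinomial_def]; exact support_trinomial_subset _ _ _ _ _ _
  -- hence no positive root other than r₁, r₂
  have hnoroot : ∀ z, 0 < z → z ≠ r₁ → z ≠ r₂ → q.eval z ≠ 0 := by
    intro z hz hz1 hz2 hqz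
    have hsub : ({r₁, r₂, z} : Finset ℝ) ⊆ q.roots.toFinset.filter (fun t => 0 < t) := by
      intro y hy
      simp only [Finset.mem_insert, Finset.mem_singleton] at hy
      rw [Finset.mem_filter, Multiset.mem_toFinset, mem_roots hqne, IsRoot.def]
      rcases hy with rfl | rfl | rfl
      · exact ⟨hroot _ (Or.inl rfl), h₁⟩
      · exact ⟨hroot _ (Or.inr rfl), h₂⟩
      · exact ⟨hqz, hz⟩
    have h3 : ({r₁, r₂, z} : Finset ℝ).card = 3 := by
      rw [Finset.card_insert_of_notMem, Finset.card_insert_of_notMem, Finset.card_singleton]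
      · simpa using fun h => hz2 h.symm
      · simp only [Finset.mem_insert, Finset.mem_singleton, not_or]; exact ⟨h₁₂.ne, fun h => hz1 h.symm⟩
    have := Finset.card_le_card hsub
    omega
  -- the bracket is eventually positive (top coefficient > 0), so by the IVT it is positive beyond r₂
  rw [genVandermonde_three_eq_eval_trinomial, ← hq]
  refine lt_of_not_ge fun hle => ?_
  have hlt : q.eval r₃ < 0 := lt_of_le_of_ne hle (hnoroot r₃ (h₂.trans h₂₃) (h₁₂.trans h₂₃).ne' h₂₃.ne')
  have hdeg : 0 < q.degree := by
    rw [Polynomial.degree_eq_natDegree hqne, hq, Polynomial.trinomial_natDegree hd₁ hd htop.ne']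
    exact_mod_cast hd₁.trans hd
  have hlc : 0 ≤ q.leadingCoeff := by
    rw [hq, Polynomial.trinomial_leadingCoeff hd₁ hd htop.ne']; exact htop.le
  have htend := Polynomial.tendsto_atTop_of_leadingCoeff_nonneg q hdeg hlc
  obtain ⟨y, hy⟩ := ((htend.eventually (Filter.eventually_gt_atTop 0)).and (Filter.eventually_gt_atTop r₃)).exists
  obtain ⟨z, hz, hqz⟩ := intermediate_value_Icc hy.2.le (q.continuous.continuousOn) ⟨hlt.le, hy.1.le⟩
  have hz3 : r₃ < z := by
    rcases eq_or_lt_of_le hz.1 with h | h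
    · rw [← h] at hqz; exact absurd hqz hlt.ne
    · exact h
  exact hnoroot z ((h₂.trans h₂₃).trans hz3) ((h₁₂.trans h₂₃).trans hz3).ne' (h₂₃.trans hz3).ne' hqz

/-! ## 5. Degenerate Gram ⇒ at most four positive roots, for an ARBITRARY six-nomial on the sumset (five roots force a nondegenerate Gram) -/

/-- Kernel vector `(ρ₀, ρ₁, 1)` of the Gram matrix: the six-nomial is the binary form `c₀g₁² + c₁g₁g₂ + c₂g₂²` of the trinomials
`g₁ = 1 − ρ₀x^{d₂}`, `g₂ = x^{d₁} − ρ₁x^{d₂}`. [folklore] -/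
private theorem sixnomial_eq_binaryForm₂ (d₁ d₂ : ℕ) (c₀ c₁ c₂ c₃ c₄ c₅ ρ₀ ρ₁ : ℝ)
    (h0 : c₀ * ρ₀ + c₁ / 2 * ρ₁ + c₃ / 2 = 0) (h1 : c₁ / 2 * ρ₀ + c₂ * ρ₁ + c₄ / 2 = 0) (h2 : c₃ / 2 * ρ₀ + c₄ / 2 * ρ₁ + c₅ = 0) :
    C c₀ * X ^ 0 + C c₁ * X ^ d₁ + C c₂ * X ^ (2 * d₁) + C c₃ * X ^ d₂ + C c₄ * X ^ (d₁ + d₂) + C c₅ * X ^ (2 * d₂)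
      = C c₀ * (C 1 * X ^ 0 + C 0 * X ^ d₁ + C (-ρ₀) * X ^ d₂) ^ 2
        + C c₁ * (C 1 * X ^ 0 + C 0 * X ^ d₁ + C (-ρ₀) * X ^ d₂) * (C 0 * X ^ 0 + C 1 * X ^ d₁ + C (-ρ₁) * X ^ d₂)
        + C c₂ * (C 0 * X ^ 0 + C 1 * X ^ d₁ + C (-ρ₁) * X ^ d₂) ^ 2 := by
  have e3 : c₃ = -(2 * c₀ * ρ₀ + c₁ * ρ₁) := by linarith
  have e4 : c₄ = -(c₁ * ρ₀ + 2 * c₂ * ρ₁) := by linarith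
  have e5 : c₅ = c₀ * ρ₀ ^ 2 + c₁ * ρ₀ * ρ₁ + c₂ * ρ₁ ^ 2 := by linear_combination h2 - (ρ₀ / 2) * e3 - (ρ₁ / 2) * e4
  rw [e3, e4, e5]
  simp only [map_neg, map_add, map_mul, map_pow, map_one, map_zero, map_ofNat]
  ring

/-- Kernel vector `(ρ₀, 1, ρ₂)`: binary form in `g₁ = 1 − ρ₀x^{d₁}`, `g₂ = x^{d₂} − ρ₂x^{d₁}`. [folklore] -/
private theorem sixnomial_eq_binaryForm₁ (d₁ d₂ : ℕ) (c₀ c₁ c₂ c₃ c₄ c₅ ρ₀ ρ₂ : ℝ)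
    (h0 : c₀ * ρ₀ + c₁ / 2 + c₃ / 2 * ρ₂ = 0) (h1 : c₁ / 2 * ρ₀ + c₂ + c₄ / 2 * ρ₂ = 0) (h2 : c₃ / 2 * ρ₀ + c₄ / 2 + c₅ * ρ₂ = 0) :
    C c₀ * X ^ 0 + C c₁ * X ^ d₁ + C c₂ * X ^ (2 * d₁) + C c₃ * X ^ d₂ + C c₄ * X ^ (d₁ + d₂) + C c₅ * X ^ (2 * d₂)
      = C c₀ * (C 1 * X ^ 0 + C (-ρ₀) * X ^ d₁ + C 0 * X ^ d₂) ^ 2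
        + C c₃ * (C 1 * X ^ 0 + C (-ρ₀) * X ^ d₁ + C 0 * X ^ d₂) * (C 0 * X ^ 0 + C (-ρ₂) * X ^ d₁ + C 1 * X ^ d₂)
        + C c₅ * (C 0 * X ^ 0 + C (-ρ₂) * X ^ d₁ + C 1 * X ^ d₂) ^ 2 := by
  have e1 : c₁ = -(2 * c₀ * ρ₀ + c₃ * ρ₂) := by linarith
  have e4 : c₄ = -(c₃ * ρ₀ + 2 * c₅ * ρ₂) := by linarith
  have e2 : c₂ = c₀ * ρ₀ ^ 2 + c₃ * ρ₀ * ρ₂ + c₅ * ρ₂ ^ 2 := by linear_combination h1 - (ρ₀ / 2) * e1 - (ρ₂ / 2) * e4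
  rw [e1, e4, e2]
  simp only [map_neg, map_add, map_mul, map_pow, map_one, map_zero, map_ofNat]
  ring

/-- Kernel vector `(1, ρ₁, ρ₂)`: binary form in `g₁ = x^{d₁} − ρ₁`, `g₂ = x^{d₂} − ρ₂`. [folklore] -/
private theorem sixnomial_eq_binaryForm₀ (d₁ d₂ : ℕ) (c₀ c₁ c₂ c₃ c₄ c₅ ρ₁ ρ₂ : ℝ)
    (h0 : c₀ + c₁ / 2 * ρ₁ + c₃ / 2 * ρ₂ = 0) (h1 : c₁ / 2 + c₂ * ρ₁ + c₄ / 2 * ρ₂ = 0) (h2 : c₃ / 2 + c₄ / 2 * ρ₁ + c₅ * ρ₂ = 0) :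
    C c₀ * X ^ 0 + C c₁ * X ^ d₁ + C c₂ * X ^ (2 * d₁) + C c₃ * X ^ d₂ + C c₄ * X ^ (d₁ + d₂) + C c₅ * X ^ (2 * d₂)
      = C c₂ * (C (-ρ₁) * X ^ 0 + C 1 * X ^ d₁ + C 0 * X ^ d₂) ^ 2
        + C c₄ * (C (-ρ₁) * X ^ 0 + C 1 * X ^ d₁ + C 0 * X ^ d₂) * (C (-ρ₂) * X ^ 0 + C 0 * X ^ d₁ + C 1 * X ^ d₂)
        + C c₅ * (C (-ρ₂) * X ^ 0 + C 0 * X ^ d₁ + C 1 * X ^ d₂) ^ 2 := by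
  have e1 : c₁ = -(2 * c₂ * ρ₁ + c₄ * ρ₂) := by linarith
  have e3 : c₃ = -(c₄ * ρ₁ + 2 * c₅ * ρ₂) := by linarith
  have e0 : c₀ = c₂ * ρ₁ ^ 2 + c₄ * ρ₁ * ρ₂ + c₅ * ρ₂ ^ 2 := by linear_combination h0 - (ρ₁ / 2) * e1 - (ρ₂ / 2) * e3
  rw [e1, e3, e0]
  simp only [map_neg, map_add, map_mul, map_pow, map_one, map_zero, map_ofNat]
  ring

/-- **DEGENERATE GRAM ⇒ AT MOST FOUR POSITIVE ROOTS, for an arbitrary six-nomial.**  Let `f = c₀ + c₁x^{d₁} + c₂x^{2d₁} + c₃x^{d₂} + c₄x^{d₁+d₂} + c₅x^{2d₂}`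
(any `d₁, d₂`; no realisability assumed) and let its Gram matrix `Q_f = [[c₀, c₁/2, c₃/2], [c₁/2, c₂, c₄/2], [c₃/2, c₄/2, c₅]]` be SINGULAR.  Then `f`, if not the zero
polynomial, has at most `4` distinct positive roots (a kernel vector of `Q_f` writes `f` as a binary quadratic form of two trinomials, `sixnomial_eq_binaryForm₀/₁/₂` — this lineage's
`card_posRoots_binaryForm_le_four`).  Contrapositive — the NONDEGENERACY third of the orientation law: FIVE positive roots force `det Q_f ≠ 0`. [folklore] -/
theorem card_posRoots_le_four_of_gram_det_eq_zero (d₁ d₂ : ℕ) (c₀ c₁ c₂ c₃ c₄ c₅ : ℝ)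
    (hQ : (!![c₀, c₁ / 2, c₃ / 2; c₁ / 2, c₂, c₄ / 2; c₃ / 2, c₄ / 2, c₅] : Matrix (Fin 3) (Fin 3) ℝ).det = 0)
    (hf : C c₀ * X ^ 0 + C c₁ * X ^ d₁ + C c₂ * X ^ (2 * d₁) + C c₃ * X ^ d₂ + C c₄ * X ^ (d₁ + d₂) + C c₅ * X ^ (2 * d₂) ≠ 0) :
    ((C c₀ * X ^ 0 + C c₁ * X ^ d₁ + C c₂ * X ^ (2 * d₁) + C c₃ * X ^ d₂ + C c₄ * X ^ (d₁ + d₂) + C c₅ * X ^ (2 * d₂)).roots.toFinset.filter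
      (fun t => 0 < t)).card ≤ 4 := by
  classical
  obtain ⟨n, hn, hk⟩ := Matrix.exists_mulVec_eq_zero_iff.2 hQ
  have hvec : n = ![n 0, n 1, n 2] := by ext i; fin_cases i <;> rfl
  have h2C : ∀ m : ℝ, (C m : ℝ[X]) = 2 * C (m / 2) := fun m => by
    rw [show (2 : ℝ[X]) = C 2 from (map_ofNat C 2).symm, ← map_mul]; congr 1; ring
  have e0 := congrFun hk 0; have e1 := congrFun hk 1; have e2 := congrFun hk 2
  rw [hvec] at e0 e1 e2
  simp only [Matrix.mulVec, dotProduct, Fin.sum_univ_three, Matrix.of_apply, Matrix.cons_val', Matrix.cons_val_zero, Matrix.cons_val_one,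
      Matrix.cons_val_two, Matrix.empty_val', Matrix.cons_val_fin_one, Matrix.head_cons, Matrix.tail_cons, Matrix.head_fin_const,
      Pi.zero_apply] at e0 e1 e2
  by_cases h2 : n 2 ≠ 0
  · have hfeq := sixnomial_eq_binaryForm₂ d₁ d₂ c₀ c₁ c₂ c₃ c₄ c₅ (n 0 / n 2) (n 1 / n 2)
      (by field_simp; linarith) (by field_simp; linarith) (by field_simp; linarith)
    rw [hfeq, h2C c₁] at hf ⊢
    exact card_posRoots_binaryForm_le_four _ _ (support_trinomial_subset _ _ _ _ _ _) (support_trinomial_subset _ _ _ _ _ _) _ _ _ hf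
  by_cases h1 : n 1 ≠ 0
  · have hfeq := sixnomial_eq_binaryForm₁ d₁ d₂ c₀ c₁ c₂ c₃ c₄ c₅ (n 0 / n 1) (n 2 / n 1)
      (by field_simp; linarith) (by field_simp; linarith) (by field_simp; linarith)
    rw [hfeq, h2C c₃] at hf ⊢
    exact card_posRoots_binaryForm_le_four _ _ (support_trinomial_subset _ _ _ _ _ _) (support_trinomial_subset _ _ _ _ _ _) _ _ _ hf
  by_cases h0 : n 0 ≠ 0
  · have hfeq := sixnomial_eq_binaryForm₀ d₁ d₂ c₀ c₁ c₂ c₃ c₄ c₅ (n 1 / n 0) (n 2 / n 0)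
      (by field_simp; linarith) (by field_simp; linarith) (by field_simp; linarith)
    rw [hfeq, h2C c₄] at hf ⊢
    exact card_posRoots_binaryForm_le_four _ _ (support_trinomial_subset _ _ _ _ _ _) (support_trinomial_subset _ _ _ _ _ _) _ _ _ hf
  rw [not_ne_iff] at h0 h1 h2
  exact absurd (by rw [hvec]; ext i; fin_cases i <;> simp [h0, h1, h2]) hn

end Summit.ValiantsHypothesis.ValiantsHypothesis.Theorems.LacunarySymmetroidMatrixDescartes.Census
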